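import Summits.CriticalPhenomena.PercolationContinuityZ3.Theorems.Transplant.Slab111VSoundA
import HarnessLib
/-!
# The routing certificate for `ShapedLinkage 3 (Slab111.hexShadow k)`, IV: soundness of the checker — face vertices and statuses

builds on p205010 (kernel theorem, internal audit signed; external expert review pending) — NOT used in this file.  Lane `prim-bschramm`, seat
`prim-bschramm-p2` (gen 35; class C1b; memo `HOME/bschramm/P2-LATTICES.md` §129); helper file (`--supports stmt-CriticalPhenomena-4575 --as helper`).
Preparations for the ride lemma («Slab111VSoundR»): arithmetic of the centre class, `colAt` on members of a face, the three ranges of `statusOf`,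
and the CLEARED-SET MEMBERSHIP of the vertices of a well-formed ride attachment (`AttD.ok`, «Slab111VPlan») at admissible levels (`rideV_mem_W`),
with the boundary cases read off `rideStatusOK`.
* §1 arithmetic (`dvd_cls`, `colAt_congr`, `colAt_eq_of_mem`, `statusOf_low/high/mid/cases`);
* §2 cleared-set membership of face vertices (`rideV_mem_W`);
* §3 reading `rideStatusOK` (`rideStatusOK_low/high`), trivial paths (`eq_vl_self`, `adm_self`).
[cite: DuminilCopinSidoraviciusTassion2016, §2.3 (proof of Fact 2: the paths γ_u, γ_v, γ_w)]
-/

noncomputable section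

namespace Summit.CriticalPhenomena.PercolationContinuityZ3.Theorems.Transplant

open Literature.Probability.Percolation Literature.Probability.LatticeModels SimpleGraph
open scoped Classical

namespace Slab111

variable {k : ℕ}


/-! ## §1 Arithmetic -/

/-- The centre class: `z₀ + 2z₁ ≡ cls z (mod 3)`. [folklore] -/
theorem dvd_cls (z : Site 2) : (3 : ℤ) ∣ z 0 + 2 * z 1 - (cls z : ℤ) := by
  unfold cls
  have h3 : (0 : ℤ) ≤ (z 0 - z 1) % 3 := Int.emod_nonneg _ (by norm_num)
  rw [Int.toNat_of_nonneg h3]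
  have := Int.emod_emod_of_dvd (z 0 - z 1) (dvd_refl (3 : ℤ))
  omega

/-- `colAt` depends on the class only. [folklore] -/
theorem colAt_congr (F : FaceD) {m m' : ℤ} (h : (3 : ℤ) ∣ m - m') : colAt F m = colAt F m' := by
  have : m % 3 = m' % 3 := by omega
  simp only [colAt, this]

/-- `colAt` returns the member of the face with the requested class. [folklore] -/
theorem colAt_eq_of_mem {F : FaceD} (hF : F.ok) {q : Col} (hq : q ∈ [F.f0, F.f1, F.f2]) {m : ℤ} (hm : (3 : ℤ) ∣ m - lvlC q) : colAt F m = q := by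
  obtain ⟨h0, h1, h2, -, -, -⟩ := hF
  simp only [List.mem_cons, List.not_mem_nil, or_false] at hq
  unfold colAt lvlC at *
  rcases hq with rfl | rfl | rfl
  · have : m % 3 = 0 := by omega
    simp [this]
  · have : m % 3 = 1 := by omega
    simp [this]
  · have : m % 3 = 2 := by omega
    simp [this]

/-- Status of a low level. [folklore] -/
theorem statusOf_low {h : ℤ} (h0 : 0 ≤ h) (h2 : h ≤ 2) : (statusOf k h : ℤ) = h := by
  unfold statusOf; rw [if_pos h2]; simp; omega

/-- Status of a high level. [folklore] -/
theorem statusOf_high {h : ℤ} (hk : 5 ≤ k) (hlo : (k : ℤ) - 2 ≤ h) (hhi : h ≤ k) : (statusOf k h : ℤ) = 12 - ((k : ℤ) - h) := by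
  unfold statusOf; rw [if_neg (by omega), if_pos hlo]; simp; omega

/-- Status of a middle level. [folklore] -/
theorem statusOf_mid {h : ℤ} (hlo : 3 ≤ h) (hhi : h ≤ (k : ℤ) - 3) : statusOf k h = 9 := by
  unfold statusOf; rw [if_neg (by omega), if_neg (by omega)]

/-- A status is at most `2`, equal to `9`, or at least `10`. [folklore] -/
theorem statusOf_cases (hk : 5 ≤ k) {h : ℤ} (h0 : 0 ≤ h) (hh : h ≤ k) :
    (h ≤ 2 ∧ (statusOf k h : ℤ) = h) ∨ (3 ≤ h ∧ h ≤ (k : ℤ) - 3 ∧ statusOf k h = 9) ∨ ((k : ℤ) - 2 ≤ h ∧ (statusOf k h : ℤ) = 12 - ((k : ℤ) - h)) := by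
  by_cases h2 : h ≤ 2
  · exact Or.inl ⟨h2, statusOf_low h0 h2⟩
  by_cases hlo : (k : ℤ) - 2 ≤ h
  · exact Or.inr (Or.inr ⟨hlo, statusOf_high hk hlo hh⟩)
  · exact Or.inr (Or.inl ⟨by omega, by omega, statusOf_mid (by omega) (by omega)⟩)

/-! ## §2 Cleared-set membership of face vertices -/

/-- The face columns of a well-formed attachment are usable (and rerouting columns for `E`-terminals). [folklore] -/
theorem AttD.ok_cols {C : Ctx} {roleE : Bool} {a : AttD} (h : a.ok C roleE = true) :
    a.F.ok ∧ (∀ q ∈ a.fcols, colW C q = true ∧ (roleE = true → colRW C q = true)) ∧ (colW C a.c = true ∧ (roleE = true → colRW C a.c = true)) ∧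
      ((a.ext = 0 ∧ a.c ∈ a.fcols) ∨ (a.ext = -1 ∧ a.c ∉ a.fcols ∧ IsUp a.tcol a.c) ∨ (a.ext = 1 ∧ a.c ∉ a.fcols ∧ IsUp a.c a.tcol)) := by
  unfold AttD.ok at h
  simp only [Bool.and_eq_true, Bool.or_eq_true, decide_eq_true_eq, List.all_eq_true, beq_iff_eq, Bool.not_eq_true', isUpB] at h
  obtain ⟨⟨⟨hF, hcols⟩, hc⟩, hext⟩ := h
  refine ⟨hF, fun q hq => ?_, ?_, ?_⟩
  · have := hcols q hq
    cases roleE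
    · simpa using this
    · simp at this; exact ⟨(colRW_split this).2, fun _ => this⟩
  · cases roleE
    · simpa using hc
    · simp at hc; exact ⟨(colRW_split hc).2, fun _ => hc⟩
  · rcases hext with (⟨h1, h2⟩ | ⟨⟨h1, h2⟩, h3⟩) | ⟨⟨h1, h2⟩, h3⟩
    · exact Or.inl ⟨h1, by simpa using h2⟩
    · exact Or.inr (Or.inl ⟨h1, by simpa using h2, by simpa using h3⟩)
    · exact Or.inr (Or.inr ⟨h1, by simpa using h2, by simpa using h3⟩)

/-- `colAt` of a face is one of its listed columns. [folklore] -/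
theorem colAt_mem_fcols (a : AttD) (m : ℤ) : colAt a.F m ∈ a.fcols := by
  rcases colAt_mem a.F m with h | h | h <;> simp [AttD.fcols, h]

/-- The footprint contains the face columns. [folklore] -/
theorem fcols_subset_foot (a : AttD) {q : Col} (h : q ∈ a.fcols) : q ∈ a.foot := List.mem_cons_of_mem _ h

/-- The footprint contains the terminal column. [folklore] -/
theorem c_mem_foot (a : AttD) : a.c ∈ a.foot := List.mem_cons_self

/-- **A face vertex of a well-formed attachment is cleared**, given the boundary code conditions of its level. [folklore] -/
theorem rideV_mem_W {z : Site 2} {K : BKey} {a : AttD} {roleE : Bool} (ha : a.ok (Ctx.of K (cls z) (k % 3)) roleE = true) {L : ℤ} (h0 : 0 ≤ L)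
    (hk : L ≤ k) (hb0 : L = 0 → codeFree (Ctx.of K (cls z) (k % 3)) 0 (colAt a.F (L - cls z)) = true)
    (hb1 : L = 1 → codeFree (Ctx.of K (cls z) (k % 3)) 1 (colAt a.F (L - cls z)) = true)
    (ht1 : L = (k : ℤ) - 1 → codeFree (Ctx.of K (cls z) (k % 3)) 2 (colAt a.F (L - cls z)) = true)
    (ht0 : L = k → codeFree (Ctx.of K (cls z) (k % 3)) 3 (colAt a.F (L - cls z)) = true) :
    rideV k z (cls z) a.F L ∈ Wset k z K.tR K.tD K.sR K.sD ∧
      (roleE = true → rideV k z (cls z) a.F L ∈ Wset k z K.tR K.tD K.sR K.sD ∩ (hexShadow k).lift (blkR 3 z K.tR K.sR)) := by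
  obtain ⟨hF, hcols, -, -⟩ := AttD.ok_cols ha
  set q := colAt a.F (L - cls z) with hq
  have hqm : q ∈ a.fcols := colAt_mem_fcols a _
  obtain ⟨hW, hR⟩ := hcols q hqm
  obtain ⟨hblk, h4⟩ := colW_spec hW
  have hs : sh (rideV k z (cls z) a.F L) = z + ![q.1, q.2] := by rw [sh_rideV (dvd_cls z) hF h0 hk]; rfl
  have hl : lev ((rideV k z (cls z) a.F L : slab111 k) : Site 3) = L := lev_rideV (dvd_cls z) hF h0 hk
  have hmem : rideV k z (cls z) a.F L ∈ Wset k z K.tR K.tD K.sR K.sD := by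
    refine ⟨by rw [hs]; exact mem_blk_of_inBlkB hblk, not_peeled_of_forall hs fun c hc hm => ?_⟩
    rw [hl] at hm
    unfold codeMatches at hm
    rcases hm with rfl | ⟨rfl, hL⟩ | ⟨rfl, hL⟩ | ⟨rfl, hL⟩ | ⟨rfl, hL⟩
    · exact h4 hc
    · exact not_mem_of_codeFree (hb0 hL) hc
    · exact not_mem_of_codeFree (hb1 hL) hc
    · exact not_mem_of_codeFree (ht1 hL) hc
    · exact not_mem_of_codeFree (ht0 hL) hc
  exact ⟨hmem, fun hr => mem_WsetR_of hs hmem (colRW_spec (hR hr)).1⟩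

/-! ## §3 The ride -/

/-- `rideStatusOK` at a low status: the extra step exists and the codes at the face levels `≤ 1` from the target level on are clean. [folklore] -/
theorem rideStatusOK_low {C : Ctx} {a : AttD} {s : ℕ} (hs : s ≤ 2) (h : rideStatusOK C a s = true) :
    ¬ (a.ext = -1 ∧ s = 0) ∧ ((s : ℤ) + a.ext ≤ 0 → codeFree C 0 (a.colBot C.c0 0) = true) ∧ ((s : ℤ) + a.ext ≤ 1 → codeFree C 1 (a.colBot C.c0 1) = true) := by
  unfold rideStatusOK at h
  rw [if_pos hs] at h
  simp only [Bool.and_eq_true, Bool.not_eq_true', Bool.and_eq_false_iff, beq_eq_false_iff_ne, ne_eq] at h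
  obtain ⟨⟨h1, h2⟩, h3⟩ := h
  refine ⟨fun ⟨he, hs0⟩ => ?_, fun ht => ?_, fun ht => ?_⟩
  · rcases h1 with h1 | h1
    · exact h1 he
    · exact h1 hs0
  · simpa [ht] using h2
  · simpa [ht] using h3

/-- `rideStatusOK` at a high status. [folklore] -/
theorem rideStatusOK_high {C : Ctx} {a : AttD} {s : ℕ} (hs : 10 ≤ s) (h : rideStatusOK C a s = true) :
    ¬ (a.ext = 1 ∧ s = 12) ∧ ((12 : ℤ) - s - a.ext ≤ 0 → codeFree C 3 (a.colTop C.c0 C.kr 0) = true) ∧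
      ((12 : ℤ) - s - a.ext ≤ 1 → codeFree C 2 (a.colTop C.c0 C.kr 1) = true) := by
  unfold rideStatusOK at h
  rw [if_neg (by omega), if_pos hs] at h
  simp only [Bool.and_eq_true, Bool.not_eq_true', Bool.and_eq_false_iff, beq_eq_false_iff_ne, ne_eq] at h
  obtain ⟨⟨h1, h2⟩, h3⟩ := h
  refine ⟨fun ⟨he, hs0⟩ => ?_, fun ht => ?_, fun ht => ?_⟩
  · rcases h1 with h1 | h1
    · exact h1 he
    · exact h1 hs0
  · simpa [ht] using h2
  · simpa [ht] using h3

/-- A film vertex is `vl` of its shadow and level. [folklore] -/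
theorem eq_vl_self (x : slab111 k) : x = vl k (sh x) (lev (x : Site 3)) := (exists_eq_vl x).2

/-- Admissibility data of a film vertex. [folklore] -/
theorem adm_self (x : slab111 k) : Adm k (sh x) (lev (x : Site 3)) := (exists_eq_vl x).1

end Slab111

end Summit.CriticalPhenomena.PercolationContinuityZ3.Theorems.Transplant
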